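import Summits.Ventures.YMGap.YM3IR.BalabanSUN
import Summits.Ventures.YMGap.RobustBall.TorusRowsSU3Star
import HarnessLib

/-!
# YM3IR / BalabanCeilingsSU3 — the §Y4 sentence for `SU(3)` on ds-2's HYPOTHESIS-FREE robust-star rows (Wilson `β_W = 1/4`
and `β_W = 1/3`), with the counted crossover (theorems only; no new conjecture name)

HONEST FRAMING (cell pub-ymgap, track Y4 / YM3-IR, seat ym3ir-theory-1, gen 7; follow-up to `YM3IR/BalabanCeilings.lean`, written once
ds-2's `RobustBall/TorusRowsSU3Star.lean` (S7) was ACCEPTED — commit `e4c7e23fa5ba` — per R212 (iii)).  This file claims NO summit, NO mass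
gap and NO part of Bałaban's theorems.
It is kernel-checked BOOKKEEPING: `BalabanSUN.massGap3Cofinal_suN_balaban_of_irConjecture3` at `N = 3` with track Y2's input
(`ClusterDomainClustering`) DISCHARGED BY NAME by ds-2's hypothesis-free `SU(3)` robust-star rows on p2's eigen modulus:
`RobustBall.su3_clusterDomainClustering_dim3_star_oneQuarter r` (tree ceiling `1/12` = Wilson `1/4`, ball `ClusterDomainFR (53/250)
(53/500) r` — the SAME ceiling as the engine-2-CONDITIONAL sentence `BalabanSU3.massGap3Cofinal_su3_balaban_of_irConjecture3`, now
without H1/H2) and `RobustBall.su3_clusterDomainClustering_dim3_star_oneThird r` (tree ceiling `1/9` = Wilson `1/3`, ball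
`ClusterDomainFR (1/10) (1/20) r` — the highest certified `SU(3)` `d = 3` ceiling).  Lattice statements only; no continuum limit, no
Millennium claim; no axiom, no `sorry`, no `def`; `0` compute.

THE HYPOTHESIS LIST, VERBATIM (`massGap3Cofinal_su3_balaban_star_oneThird_of_irConjecture3`): `BalabanUV3 mk` — IN PRINT (Bałaban,
CMP 102 (1985), Thm 1 p. 257 + Thm 2 p. 272), EVIDENTIAL (theory-2 F2: the kernel arrow does not consume it); `Nonempty (Family L eps0)`
— print's clauses at one coupling (p. 256 L15–18); `0 < C_b`, `0 < κ`; `IRConjecture3 (ballOfRobustBallFR 3 (1/10) (1/20) r (1/9))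
suFrobDist (fundamentalRep (Fin 3)) (balabanCouplings L (suGroupModel 3) eps0) C_b κ` — the ONE CONJECTURE of record (theory-2,
`YM3IR/Statement.lean`; NOT in print).  LABEL OF RECORD (R196, verbatim): with existential `(C_b, κ)` a «dictionary, not a reduction»
(forest witness, theory-2 monolith `36c0d2dbfa902023`).  CONCLUSION: `MassGap3Cofinal (balabanCouplings L (suGroupModel 3) eps0)
suFrobDist (fundamentalRep (Fin 3))`.

COUNTED CROSSOVER (PROVED arithmetic, tree units `β = β_W/3`): below the ceiling `1/9` after `K + M'` steps iff `L^{M'} ≥ 3/γ₀²`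
(`su3_betaTree_div_pow_le_ninth_iff`; `≥ 3` with `γ₀² ≤ 1`), vs `4/γ₀²` at `1/12` (`BalabanSU3.su3_betaTree_div_pow_le_twelfth_iff`) and
`40/(9γ₀²)` on p1's every-`N` row (`BalabanCeilings.su3_row40_crossover_steps`).

WHY THIS IS NOVEL (one sentence).  The `SU(3)` — physical colour group — instance of «print + certified strong-coupling expansion + ONE
named conjecture ⟹ lattice YM₃ mass gap on Bałaban's coupling set» with Y2's input a HYPOTHESIS-FREE theorem up to Wilson `β_W = 1/3`
and its explicit crossover count `L^{M'} ≥ 3/γ₀²`.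

References: T. Bałaban, CMP 102 (1985) 255–275, p. 256 L15–18, (5) p. 256, Thm 1 p. 257, Thm 2 p. 272 [cite: Balaban1985UV3].
-/

noncomputable section

open MeasureTheory
open Literature.MathematicalPhysics.QuantumLattice Literature.MathematicalPhysics.QuantumFieldTheory
open Balaban1985CMP102 Balaban1985CMP102.Setting Balaban1985CMP102.Theorems
open Literature.MathematicalPhysics.QuantumFieldTheory.Balaban1983to89 (GaugeGroup HaarData)
open Summit.QuantumFields.Balaban3D.Carriers (suGroupModel)

namespace Summit.Ventures.YMGap.YM3IR

open CarrierBridge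

/-- **`SU(3)` lattice YM₃ mass gap on Bałaban's coupling set, receiving at Wilson `β_W = 1/3`, Y2's input HYPOTHESIS-FREE (PROVED
bookkeeping).**  ds-2's robust-star row `RobustBall.su3_clusterDomainClustering_dim3_star_oneThird r` BY NAME (tree ceiling `1/9`, ball
`ClusterDomainFR (1/10) (1/20) r`, some rate `m > 0`).  EXACTLY ONE hypothesis is neither in print nor certified: `IRConjecture3`
(label of record: with existential `(C_b, κ)` a dictionary, not a reduction). [cite: Balaban1985UV3, Thm 1 p.257; Thm 2 p.272] -/
theorem massGap3Cofinal_su3_balaban_star_oneThird_of_irConjecture3 {L : ℕ} {mk : Construction L} {eps0 : ℝ → ℝ}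
    (hfam : Nonempty (Family L eps0)) (r : ℕ) {C_b κ : ℝ} (hC : 0 < C_b) (hκ : 0 < κ) (hUV : BalabanUV3 mk)
    (hIR : IRConjecture3 (ballOfRobustBallFR 3 (1 / 10) (1 / 20) r (1 / 9)) suFrobDist (fundamentalRep (Fin 3))
      (balabanCouplings L (suGroupModel 3) eps0) C_b κ) :
    MassGap3Cofinal (balabanCouplings L (suGroupModel 3) eps0) suFrobDist
      (fundamentalRep (Fin 3) : RobustBall.SUN 3 →* Matrix (Fin 3) (Fin 3) ℂ) := by
  obtain ⟨m, hm, hRB, -⟩ := RobustBall.su3_clusterDomainClustering_dim3_star_oneThird r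
  exact massGap3Cofinal_suN_balaban_of_irConjecture3 hfam hC hκ hm hUV hRB hIR

/-- **The same at Wilson `β_W = 1/4` (tree ceiling `1/12`), Y2's input HYPOTHESIS-FREE (PROVED bookkeeping):** ds-2's
`RobustBall.su3_clusterDomainClustering_dim3_star_oneQuarter r` (ball `ClusterDomainFR (53/250) (53/500) r`) in place of engine-2's
H1/H2-conditional row of `BalabanSU3.massGap3Cofinal_su3_balaban_of_irConjecture3` — same ceiling, no cell hypothesis; the ONE
non-printed, non-certified hypothesis is `IRConjecture3` (label of record R196: with existential `(C_b, κ)` a dictionary, not a reduction).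
[cite: Balaban1985UV3, Thm 1 p.257; Thm 2 p.272] -/
theorem massGap3Cofinal_su3_balaban_star_oneQuarter_of_irConjecture3 {L : ℕ} {mk : Construction L} {eps0 : ℝ → ℝ}
    (hfam : Nonempty (Family L eps0)) (r : ℕ) {C_b κ : ℝ} (hC : 0 < C_b) (hκ : 0 < κ) (hUV : BalabanUV3 mk)
    (hIR : IRConjecture3 (ballOfRobustBallFR 3 (53 / 250) (53 / 500) r (1 / 12)) suFrobDist (fundamentalRep (Fin 3))
      (balabanCouplings L (suGroupModel 3) eps0) C_b κ) :
    MassGap3Cofinal (balabanCouplings L (suGroupModel 3) eps0) suFrobDist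
      (fundamentalRep (Fin 3) : RobustBall.SUN 3 →* Matrix (Fin 3) (Fin 3) ℂ) := by
  obtain ⟨m, hm, hRB, -⟩ := RobustBall.su3_clusterDomainClustering_dim3_star_oneQuarter r
  exact massGap3Cofinal_suN_balaban_of_irConjecture3 hfam hC hκ hm hUV hRB hIR

/-- **In PRINT'S quantifier order at `β_W = 1/3` (PROVED bookkeeping):** `∃ eps0` first (print, p. 256 L15–18), then for every `r`,
`C_b`, `κ`: `IRConjecture3` on the row's ball (label of record R196: a dictionary, not a reduction) ⟹ `MassGap3Cofinal`.
[cite: Balaban1985UV3, p.256 L15–18; Thm 2 p.272] -/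
theorem massGap3Cofinal_su3_balaban_star_oneThird_printedOrder_of_irConjecture3 {L : ℕ} (mk : Construction L)
    (hUV : BalabanUV3 mk) :
    ∃ eps0 : ℝ → ℝ, (∀ g : ℝ, 0 < g → 0 < eps0 g) ∧
      (∀ S : Family L eps0, ∀ k, k ≤ S.1.K → (mk (RobustBall.SUN 3) (suGroupModel 3) S.1).ineq41_47 k) ∧
      ∀ (r : ℕ) (C_b κ : ℝ), 0 < C_b → 0 < κ → Nonempty (Family L eps0) →
        IRConjecture3 (ballOfRobustBallFR 3 (1 / 10) (1 / 20) r (1 / 9)) suFrobDist (fundamentalRep (Fin 3))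
          (balabanCouplings L (suGroupModel 3) eps0) C_b κ →
          MassGap3Cofinal (balabanCouplings L (suGroupModel 3) eps0) suFrobDist
            (fundamentalRep (Fin 3) : RobustBall.SUN 3 →* Matrix (Fin 3) (Fin 3) ℂ) := by
  obtain ⟨eps0, hpos, h2, h⟩ := massGap3Cofinal_suN_balaban_printedOrder_of_irConjecture3 (N := 3) mk hUV
  refine ⟨eps0, hpos, h2, fun r C_b κ hC hκ hfam hIR => ?_⟩
  obtain ⟨m, hm, hRB, -⟩ := RobustBall.su3_clusterDomainClustering_dim3_star_oneThird r
  exact h (ballOfRobustBallFR 3 (1 / 10) (1 / 20) r (1 / 9)) C_b κ m hC hκ hm hfam hRB hIR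

/-- **`SU(3)` at the certified ceiling `β⋆ = 1/9` (`β_W = 1/3`; PROVED arithmetic):** a member's coupling after `K + M'` steps is
below `1/9` iff `L^{M'} ≥ 3/γ₀²`. [cite: Balaban1985UV3, (5) p.256] -/
theorem su3_betaTree_div_pow_le_ninth_iff {L : ℕ} (S : Scales L) (M' : ℕ) :
    betaTree (suGroupModel 3) S / (L : ℝ) ^ (S.K + M') ≤ 1 / 9 ↔ 3 / Dictionary.gammaSq S ≤ (L : ℝ) ^ M' := by
  rw [suN_betaTree_div_pow_le_iff S M' (by norm_num : (0 : ℝ) < 1 / 9)]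
  have e : (((3 : ℕ) : ℝ) * Dictionary.gammaSq S * (1 / 9))⁻¹ = 3 / Dictionary.gammaSq S := by
    have e1 : ((3 : ℕ) : ℝ) * Dictionary.gammaSq S * (1 / 9) = Dictionary.gammaSq S / 3 := by
      push_cast
      ring
    rw [e1, inv_div]
  rw [e]

/-- Hence at `β⋆ = 1/9` for `SU(3)` (PROVED arithmetic; `γ₀² ≤ 1`): in the window after `K + M'` steps forces `3 ≤ L^{M'}`.
[cite: Balaban1985UV3, (5) p.256] -/
theorem su3_three_le_pow_of_betaTree_div_pow_le_ninth {L : ℕ} (S : Scales L) (M' : ℕ)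
    (h : betaTree (suGroupModel 3) S / (L : ℝ) ^ (S.K + M') ≤ 1 / 9) : (3 : ℝ) ≤ (L : ℝ) ^ M' := by
  have hγ : 0 < Dictionary.gammaSq S := Dictionary.gammaSq_pos S
  have hγ1 : Dictionary.gammaSq S ≤ 1 := Dictionary.gammaSq_le_one S
  have h3 : 3 / Dictionary.gammaSq S ≤ (L : ℝ) ^ M' := (su3_betaTree_div_pow_le_ninth_iff S M').1 h
  have h33 : (3 : ℝ) ≤ 3 / Dictionary.gammaSq S := by
    rw [le_div_iff₀ hγ]
    nlinarith
  exact h33.trans h3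

/-- **The conjecture's counted task on the `SU(3)` `β_W = 1/3` row (PROVED arithmetic), at the row's ball for the record.**
[cite: Balaban1985UV3, (5) p.256] -/
theorem su3_row_star_oneThird_crossover_steps {L : ℕ} (S : Scales L) (M' : ℕ)
    (h : betaTree (suGroupModel 3) S / (L : ℝ) ^ (S.K + M') ≤
      (ballOfRobustBallFR 3 (1 / 10) (1 / 20) 0 (1 / 9)).βstar) :
    (3 : ℝ) ≤ (L : ℝ) ^ M' :=
  su3_three_le_pow_of_betaTree_div_pow_le_ninth S M' h

end Summit.Ventures.YMGap.YM3IR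

end
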